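import Mathlib
import Summits.Ventures.PercRepro2.HCov
import Summits.Ventures.PercRepro2.BHKOutside
import Summits.Ventures.PercRepro2.ISplit
import Summits.Ventures.PercRepro2.FirstOrderTerms
import Summits.Ventures.PercRepro2.PendantWKernel

/-!
# `W ≥ 0` — the candidate that closes the regime `γ > γ₀` of the degree-one-root contraction
(blind cell PercRepro2, p5 g22; `proofs/P5-OEDGE.md` §28 addendum 2; kernel and functionals in `PendantWKernel.lean`)

With `Q = {a₁ ↮ a₂}`, `PD`, `T` (`PDEvent`, `TEvent`), `D = P(PD)`, `t = P(T)`, `Q = P(Q)`, `β = P(b ↔ a₁)`,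
`D₀ = P(a₃ ∉ C₁)`, `S_b = E[σ_b; Q] = P(Q, b ∈ C₁) − P(Q, b ∈ C₂)`, `c_g = P(PD ∪ T, b ∈ C₂) − P(T, b ∈ C₁)`:

  **`W = (D − Q·D₀)·c_g + t·(D·β − D₀·S_b)`  (`= D·∂_gΨ(β) − Q·D₀·∂_gΨ(σ̄_b)`)  is ≥ 0**

on every instance (`W_nonneg`).  PROOF: explore `K = C₂` under `a₁ ∉ K`; with `r = 1_{a₁ ∉ K}`,
`i = 1_{a₃ ∈ K}`, `j = 1_{b ∈ K}`, `u = 1_{a₁ ∉ K}·P_{G∖K}(a₃ ∈ C₁)`, `v = 1_{a₁ ∉ K}·P_{G∖K}(b ∈ C₁)` the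
eight masses are `D = E[(1 − i)(r − u)]`, `P(PD, bH) = E[(1 − i) j (r − u)]`, `t = E[i r]`, `P(T, bH) = E[i j r]`,
`P(T, bL) = E[i v]`, `Q = E[r]`, `P(Q, bL) = E[v]`, `P(Q, bH) = E[j r]` (`mass_*`), so `W` is the double sum
`Σ_{ω, ω'} w(ω) w(ω') wKer(ω, ω')`, and the SYMMETRISED kernel is non-negative POINTWISE
(`wKer_symm_nonneg`, `PendantWKernel.lean`).
-/

namespace Summit.Ventures.PercRepro2

open UnionCluster

namespace CovForm

namespace FirstOrder

section Main

variable {V : Type*} {E : Type*} [Fintype E] [DecidableEq E] [Fintype V] [DecidableEq V]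
  {R : Type*} [Field R] [LinearOrder R] [IsStrictOrderedRing R]

omit [LinearOrder R] [IsStrictOrderedRing R] in
/-- `D = E[(1 − i)(r − u)]`. -/
lemma mass_PD (p : E → R) (ends : E → Sym2 V) (a₁ a₂ a₃ : V) :
    prob p (PDEvent ends a₁ a₂ a₃) =
      expect p (fun ω => (1 - iI ends a₂ a₃ ω) * (rI ends a₁ a₂ ω - uO p ends a₁ a₂ a₃ ω)) := by
  classical
  set A := clusterInEvent ends a₂ {W : Set V | a₃ ∉ W} ∩ avoidAll ends a₂ {a₁} with hA
  set B := clusterInEvent ends a₁ {W : Set V | a₃ ∈ W} with hB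
  have hs := prob_inter_add_prob_inter_compl p A B
  rw [PDEvent_eq_explore]
  have h1 : prob p (A ∩ B) = expect p (fun ω => (1 - iI ends a₂ a₃ ω) * uO p ends a₁ a₂ a₃ ω) := by
    have e : A ∩ B = clusterInEvent ends a₂ {W : Set V | a₃ ∉ W} ∩
        clusterInEvent ends a₁ {W : Set V | a₃ ∈ W} ∩ avoidAll ends a₂ {a₁} := by
      rw [hA, hB]; ext ω; simp only [Set.mem_inter_iff]; tauto
    rw [e, prob_explore_C2]
    refine congrArg (expect p) (funext fun ω => ?_)
    rw [indicator_notMem_eq]; rfl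
  have h2 : prob p A = expect p (fun ω => (1 - iI ends a₂ a₃ ω) * rI ends a₁ a₂ ω) := by
    rw [hA, prob_C2_event]
    refine congrArg (expect p) (funext fun ω => ?_)
    rw [indicator_notMem_eq]
  have h3 : prob p (A ∩ Bᶜ) = prob p A - prob p (A ∩ B) := by rw [← hs]; ring
  rw [h3, h2, h1, ← expect_sub]
  refine congrArg (expect p) (funext fun ω => ?_)
  simp only [Pi.sub_apply]; ring

omit [LinearOrder R] [IsStrictOrderedRing R] in
/-- `P(PD, b ∈ C₂) = E[(1 − i) j (r − u)]`. -/
lemma mass_PDbH (p : E → R) (ends : E → Sym2 V) (a₁ a₂ a₃ b : V) :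
    prob p (PDEvent ends a₁ a₂ a₃ ∩ connEvent ends a₂ b) =
      expect p (fun ω => (1 - iI ends a₂ a₃ ω) * iI ends a₂ b ω *
        (rI ends a₁ a₂ ω - uO p ends a₁ a₂ a₃ ω)) := by
  classical
  set A := clusterInEvent ends a₂ {W : Set V | a₃ ∉ W ∧ b ∈ W} ∩ avoidAll ends a₂ {a₁} with hA
  set B := clusterInEvent ends a₁ {W : Set V | a₃ ∈ W} with hB
  have hs := prob_inter_add_prob_inter_compl p A B
  rw [PDEvent_inter_bH_eq_explore]
  have h1 : prob p (A ∩ B) =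
      expect p (fun ω => (1 - iI ends a₂ a₃ ω) * iI ends a₂ b ω * uO p ends a₁ a₂ a₃ ω) := by
    have e : A ∩ B = clusterInEvent ends a₂ {W : Set V | a₃ ∉ W ∧ b ∈ W} ∩
        clusterInEvent ends a₁ {W : Set V | a₃ ∈ W} ∩ avoidAll ends a₂ {a₁} := by
      rw [hA, hB]; ext ω; simp only [Set.mem_inter_iff]; tauto
    rw [e, prob_explore_C2]
    refine congrArg (expect p) (funext fun ω => ?_)
    rw [indicator_notMem_mem_eq]; rfl
  have h2 : prob p A = expect p (fun ω => (1 - iI ends a₂ a₃ ω) * iI ends a₂ b ω * rI ends a₁ a₂ ω) := by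
    rw [hA, prob_C2_event]
    refine congrArg (expect p) (funext fun ω => ?_)
    rw [indicator_notMem_mem_eq]; rfl
  have h3 : prob p (A ∩ Bᶜ) = prob p A - prob p (A ∩ B) := by rw [← hs]; ring
  rw [h3, h2, h1, ← expect_sub]
  refine congrArg (expect p) (funext fun ω => ?_)
  simp only [Pi.sub_apply]; ring

omit [Fintype V] [DecidableEq V] [LinearOrder R] [IsStrictOrderedRing R] in
/-- `t = E[i r]`. -/
lemma mass_T (p : E → R) (ends : E → Sym2 V) (a₁ a₂ a₃ : V) :
    prob p (TEvent ends a₁ a₂ a₃) = expect p (fun ω => iI ends a₂ a₃ ω * rI ends a₁ a₂ ω) := by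
  rw [TEvent_eq_explore, prob_C2_event]; rfl

omit [Fintype V] [DecidableEq V] [LinearOrder R] [IsStrictOrderedRing R] in
/-- `P(T, b ∈ C₂) = E[i j r]`. -/
lemma mass_TbH (p : E → R) (ends : E → Sym2 V) (a₁ a₂ a₃ b : V) :
    prob p (TEvent ends a₁ a₂ a₃ ∩ connEvent ends a₂ b) =
      expect p (fun ω => iI ends a₂ a₃ ω * iI ends a₂ b ω * rI ends a₁ a₂ ω) := by
  have e : TEvent ends a₁ a₂ a₃ ∩ connEvent ends a₂ b =
      clusterInEvent ends a₂ {W : Set V | a₃ ∈ W ∧ b ∈ W} ∩ avoidAll ends a₂ {a₁} := by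
    rw [TEvent_eq_explore]; ext ω
    simp only [Set.mem_inter_iff, mem_clusterInEvent, Set.mem_setOf_eq, mem_cluster, mem_connEvent]
    tauto
  rw [e, prob_C2_event]
  refine congrArg (expect p) (funext fun ω => ?_)
  rw [indicator_mem_mem_eq]; rfl

omit [LinearOrder R] [IsStrictOrderedRing R] in
/-- `P(T, b ∈ C₁) = E[i v]`. -/
lemma mass_TbL (p : E → R) (ends : E → Sym2 V) (a₁ a₂ a₃ b : V) :
    prob p (TEvent ends a₁ a₂ a₃ ∩ connEvent ends a₁ b) =
      expect p (fun ω => iI ends a₂ a₃ ω * uO p ends a₁ a₂ b ω) := by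
  have e : TEvent ends a₁ a₂ a₃ ∩ connEvent ends a₁ b =
      clusterInEvent ends a₂ {W : Set V | a₃ ∈ W} ∩ clusterInEvent ends a₁ {W : Set V | b ∈ W} ∩
        avoidAll ends a₂ {a₁} := by
    rw [TEvent_eq_explore, ← connEvent_eq_clusterInEvent ends a₁ b]; ext ω
    simp only [Set.mem_inter_iff]; tauto
  rw [e, prob_explore_C2]; rfl

omit [Fintype V] [DecidableEq V] [LinearOrder R] [IsStrictOrderedRing R] in
/-- `Q = E[r]`. -/
lemma mass_Q (p : E → R) (ends : E → Sym2 V) (a₁ a₂ : V) :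
    prob p (avoidAll ends a₂ {a₁}) = expect p (fun ω => rI ends a₁ a₂ ω) := by
  rw [prob_eq_expect_indicator]; rfl

omit [LinearOrder R] [IsStrictOrderedRing R] in
/-- `P(Q, b ∈ C₁) = E[v]`. -/
lemma mass_QbL (p : E → R) (ends : E → Sym2 V) (a₁ a₂ b : V) :
    prob p (avoidAll ends a₂ {a₁} ∩ connEvent ends a₁ b) =
      expect p (fun ω => uO p ends a₁ a₂ b ω) := by
  have e : avoidAll ends a₂ {a₁} ∩ connEvent ends a₁ b =
      clusterInEvent ends a₂ Set.univ ∩ clusterInEvent ends a₁ {W : Set V | b ∈ W} ∩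
        avoidAll ends a₂ {a₁} := by
    rw [← connEvent_eq_clusterInEvent ends a₁ b]; ext ω
    simp only [Set.mem_inter_iff, mem_clusterInEvent, Set.mem_univ, true_and]; tauto
  rw [e, prob_explore_C2]
  refine congrArg (expect p) (funext fun ω => ?_)
  rw [Set.indicator_univ, Pi.one_apply, one_mul]; rfl

omit [Fintype V] [DecidableEq V] [LinearOrder R] [IsStrictOrderedRing R] in
/-- `P(Q, b ∈ C₂) = E[j r]`. -/
lemma mass_QbH (p : E → R) (ends : E → Sym2 V) (a₁ a₂ b : V) :
    prob p (avoidAll ends a₂ {a₁} ∩ connEvent ends a₂ b) =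
      expect p (fun ω => iI ends a₂ b ω * rI ends a₁ a₂ ω) := by
  have e : avoidAll ends a₂ {a₁} ∩ connEvent ends a₂ b =
      clusterInEvent ends a₂ {W : Set V | b ∈ W} ∩ avoidAll ends a₂ {a₁} := by
    rw [← connEvent_eq_clusterInEvent ends a₂ b, Set.inter_comm]
  rw [e, prob_C2_event]; rfl

omit [Fintype V] [DecidableEq V] [LinearOrder R] [IsStrictOrderedRing R] in
/-- `E[f]·E[g]` as a double sum. -/
lemma expect_mul_expect_eq_double (p : E → R) (f g : Config E → R) :
    expect p f * expect p g = ∑ ω, ∑ ω', weight p ω * weight p ω' * (f ω * g ω') := by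
  unfold expect
  rw [Finset.sum_mul_sum]
  refine Finset.sum_congr rfl fun ω _ => Finset.sum_congr rfl fun ω' _ => by ring

/-- **`W ≥ 0`** on every instance:
`0 ≤ (D − Q·D₀)·(P(PD, bH) + P(T, bH) − P(T, bL)) + t·(D·β − D₀·(P(Q, bL) − P(Q, bH)))`. -/
theorem W_nonneg (p : E → R) (hp : IsProbVec p) (ends : E → Sym2 V) (a₁ a₂ a₃ b : V) :
    0 ≤ (prob p (PDEvent ends a₁ a₂ a₃) - prob p (avoidAll ends a₂ {a₁}) * D0 p ends a₁ a₃) *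
        (prob p (PDEvent ends a₁ a₂ a₃ ∩ connEvent ends a₂ b) +
          prob p (TEvent ends a₁ a₂ a₃ ∩ connEvent ends a₂ b) -
          prob p (TEvent ends a₁ a₂ a₃ ∩ connEvent ends a₁ b)) +
      prob p (TEvent ends a₁ a₂ a₃) *
        (prob p (PDEvent ends a₁ a₂ a₃) * beta p ends a₁ b -
          D0 p ends a₁ a₃ * (prob p (avoidAll ends a₂ {a₁} ∩ connEvent ends a₁ b) -
            prob p (avoidAll ends a₂ {a₁} ∩ connEvent ends a₂ b))) := by
  classical
  rw [mass_PD, mass_PDbH, mass_T, mass_TbH, mass_TbL, mass_Q, mass_QbL, mass_QbH]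
  set D₀ := D0 p ends a₁ a₃ with hD₀def
  set β := beta p ends a₁ b with hβdef
  set r : Config E → R := fun ω => rI ends a₁ a₂ ω with hr
  set i : Config E → R := fun ω => iI ends a₂ a₃ ω with hi
  set j : Config E → R := fun ω => iI ends a₂ b ω with hj
  set u : Config E → R := fun ω => uO p ends a₁ a₂ a₃ ω with hu
  set v : Config E → R := fun ω => uO p ends a₁ a₂ b ω with hv
  -- the four functionals `A, B, C, Dd` of the two-copy kernel
  set A : Config E → R := fun ω => (1 - i ω) * (r ω - u ω) - D₀ * r ω with hA
  set B : Config E → R := fun ω =>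
    (1 - i ω) * j ω * (r ω - u ω) + i ω * j ω * r ω - i ω * v ω with hB
  set C : Config E → R := fun ω => i ω * r ω with hC
  set Dd : Config E → R := fun ω => (1 - i ω) * (r ω - u ω) * β - D₀ * (v ω - r ω * j ω) with hDd
  have eA : expect p (fun ω => (1 - i ω) * (r ω - u ω)) - expect p (fun ω => r ω) * D₀ = expect p A := by
    unfold expect; rw [Finset.sum_mul, ← Finset.sum_sub_distrib]
    refine Finset.sum_congr rfl fun ω _ => by simp only [hA]; ring
  have eB : expect p (fun ω => (1 - i ω) * j ω * (r ω - u ω)) +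
      expect p (fun ω => i ω * j ω * r ω) - expect p (fun ω => i ω * v ω) = expect p B := by
    unfold expect; rw [← Finset.sum_add_distrib, ← Finset.sum_sub_distrib]
    refine Finset.sum_congr rfl fun ω _ => by simp only [hB]; ring
  have eD : expect p (fun ω => (1 - i ω) * (r ω - u ω)) * β -
      D₀ * (expect p (fun ω => v ω) - expect p (fun ω => j ω * r ω)) = expect p Dd := by
    unfold expect
    rw [Finset.sum_mul, ← Finset.sum_sub_distrib, Finset.mul_sum, ← Finset.sum_sub_distrib]
    refine Finset.sum_congr rfl fun ω _ => by simp only [hDd]; ring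
  rw [eA, eB, eD]
  show 0 ≤ expect p A * expect p B + expect p C * expect p Dd
  rw [expect_mul_expect_eq_double, expect_mul_expect_eq_double, ← Finset.sum_add_distrib]
  simp only [← Finset.sum_add_distrib]
  -- the double sum of the kernel
  have hker : ∀ ω ω', weight p ω * weight p ω' * (A ω * B ω') + weight p ω * weight p ω' * (C ω * Dd ω') =
      weight p ω * weight p ω' * wKer D₀ β (r ω) (i ω) (u ω) (r ω') (i ω') (j ω') (u ω') (v ω') := by
    intro ω ω'; simp only [hA, hB, hC, hDd, wKer]; ring
  simp only [hker]
  -- symmetrise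
  set S := ∑ ω, ∑ ω', weight p ω * weight p ω' *
    wKer D₀ β (r ω) (i ω) (u ω) (r ω') (i ω') (j ω') (u ω') (v ω') with hS
  set S' := ∑ ω, ∑ ω', weight p ω * weight p ω' *
    wKer D₀ β (r ω') (i ω') (u ω') (r ω) (i ω) (j ω) (u ω) (v ω) with hS'def
  have hS' : S = S' := by
    rw [hS, hS'def, Finset.sum_comm]
    refine Finset.sum_congr rfl fun ω _ => Finset.sum_congr rfl fun ω' _ => by ring
  have h2 : 0 ≤ S + S' := by
    rw [hS, hS'def, ← Finset.sum_add_distrib]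
    simp only [← Finset.sum_add_distrib]
    refine Finset.sum_nonneg fun ω _ => Finset.sum_nonneg fun ω' _ => ?_
    rw [← mul_add]
    refine mul_nonneg (mul_nonneg (weight_nonneg hp ω) (weight_nonneg hp ω')) ?_
    have hD₀0 : 0 ≤ D₀ := prob_nonneg hp _
    have hD₀1 : D₀ ≤ 1 := prob_le_one hp _
    have hu1 := uO_bounds p hp ends a₁ a₂ a₃ ω
    have hu2 := uO_bounds p hp ends a₁ a₂ a₃ ω'
    have hv1 := vO_bounds p hp ends a₁ a₂ b ω
    have hv2 := vO_bounds p hp ends a₁ a₂ b ω'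
    have := wKer_symm_nonneg D₀ β (r ω) (i ω) (j ω) (u ω) (v ω) (r ω') (i ω') (j ω') (u ω') (v ω')
      hD₀0 hD₀1 (rI_zero_or_one ends a₁ a₂ ω) (rI_zero_or_one ends a₁ a₂ ω')
      (iI_zero_or_one ends a₂ a₃ ω) (iI_zero_or_one ends a₂ a₃ ω') (iI_zero_or_one ends a₂ b ω)
      (iI_zero_or_one ends a₂ b ω') hu1.1 hu1.2 hu2.1 hu2.2 hv1.1 hv1.2 hv2.1 hv2.2
    linarith [this]
  rw [← hS'] at h2
  linarith [h2]

end Main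

end FirstOrder

end CovForm

end Summit.Ventures.PercRepro2
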